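/-
[Liu 2021] §4.2 / Thm. 4.18 presented through Appendix C — the ONE-OBJECT `Thm418Rest` (CARRIERS-PLAN step S1 = §2.R3, row
«X3-Obj∕Ω» AT THE INSTANCE).  KERNEL CONTENT AUTHORED by planner-pub-hodgecm2-s2crux-idea-1-g12-0 (s2crux-idea-1 gen 12, shelf sketch
`pub-hodgecm2-s2crux-idea-1/RouteO-ObjOmega-Sketch.lean` v1.1 md5 9767e630738c, 347 l., farm rc 0 · 0 warn · 0 sorry · axioms trio,
2026-08-22T00:58Z; ROUTES.md §15); row and reading by prover-pub-hodgecm-own-htheta-g4-0 (X3-CARRIERS.md v3.1 5339d03c294d §5.1); CM-side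
owner word prover-pub-hodgecm2-pin-2-g2-0 (pub-hodgecm2/INBOX l.6718: the one-object instance ENDORSED; `i ∕ hdim ∕ hdet45` are
PROJECTIONS of ONE chosen datum); path and names by the stage-2 lead planner-pub-hodgecm2-lead-g8-0 (S1 NAMING WORD, l.6745).  Brought to
tree form (namespace per directory + `RestOne`, docstring and provenance tag on every declaration, the module-structure instances SCOPED
to the namespace, the `HomK` certificate as a theorem) and FILED by seat prover-pub-hodgecm2-hcmisog-glue-g5-0 (hcmisog-glue gen 5, default
filer per l.6745).  Definitions + theorems; no named fact, no `sorry`, no new axiom.  HC_CM is NOT proved; S2 is NOT closed.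
-/
import Literature.NumberTheory.Automorphic.Liu2021.AppendixC.Glue
import Literature.NumberTheory.Automorphic.Liu2021.Def45AsPrinted
import Literature.NumberTheory.Automorphic.Liu2021.Thm418ValueField
import Literature.AlgebraicGeometry.Motives.AbelianVarietyEndAlgebraIsogenyInvariance
import Mathlib.Algebra.Colimit.Module
import Mathlib.RingTheory.TensorProduct.Maps
import HarnessLib

/-!
# Liu 2021, Thm. 4.18 through Appendix C: the one-object rest `restOne` — `Obj`, `A_μ`, `Ω(μ)`, `res`, `res_pull` CONSTRUCTED

`AppendixC/Glue.lean` POSITS, in `structure Thm418Rest C` (the fields of `Thm418Data` not supplied by the Appendix-C datum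
`C : Sec42Data P5 isotropicAt`), the objects `D_μ ∈ 𝒜(μ)` (`Obj`, with `Aμ : Obj → AbelianVariety E`, [Liu2021] Def. 4.5 (2)–(3),
`FJcycle.tex` l. 1944–1964), the module `Ω(μ)` over `M_μ` with its `𝔾(𝔸_F^∞)`-action (Def. 4.16, l. 2219) and the canonical maps
`res_K : Hom_E(A_K, A_μ)_ℚ → Ω(μ)` compatible with pull-back (l. 2070–2072, Rem. 4.17).  THIS FILE CONSTRUCTS the `Obj ∕ Aμ ∕ Ω ∕ res ∕
res_pull` part (and carries `μ` with its two printed hypotheses) from a Def. 4.5 (2) character datum `(μ, hμ, hw, Car)` in the AS-PRINTED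
typing `Def45.CMDatum φ ι hμ hw Car` (`Liu2021/Def45AsPrinted.lean`), with NO hypothesis:
1. `QHom X B = ℚ ⊗_ℤ Hom_k(X, B)`; the postcomposition action of `End(B)` (Mathlib `Preadditive.rightComp`, base-changed to `ℚ ⊗_ℤ –`),
   `postRingHom : End B →+* Module.End ℚ (QHom X B)`, extended to `End⁰(B) = ℚ ⊗_ℤ End(B)` by `Algebra.TensorProduct.lift` exactly as the
   tree does in `Motives/AbelianVarietyEndAlgebraIsogenyInvariance.lean` (`postAlg`).
2. «`M_μ` acts via `i_μ`» (Def. 4.16, l. 2219): the `S`-module structure on `QHom X B` induced by a ring homomorphism `S →+* End⁰(B)`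
   (class `EndScalar S B`, instance `moduleQHom` — SCOPED to this namespace: `open …AppendixC.RestOne` to use them), and the `S`-linearity
   of precomposition (`preₛ`; pre- and post-composition commute, `pre_postAlg`, via the tree's `endAlgebra.exists_eq_algebraMap_mul_of`).
3. The one-object index: `ObjOne := PLift (Nonempty (Def45.CMDatum φ ι hμ hw Car))` — a `Type` (the universe wall `Thm418Rest.Obj : Type`
   vs `Def45.CMDatum : Type 1` is met by `PLift : Prop → Type`), a subsingleton; «Take an arbitrary object `D_μ ∈ 𝒜(μ)`» (proof of
   Thm. 4.18, l. 2232) is `datum D := Classical.choice D.down`, `AμOne D := (datum D).A`; the reading binders `i ∕ hdim ∕ hdet45` of the COR-CM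
   END displays become the PROJECTIONS `iOne ∕ hdimOne ∕ hdet45One` of that ONE chosen datum; `nonempty_objOne_iff : Nonempty ObjOne ↔
   Nonempty (CMDatum …)` — [Liu2021] Prop. 4.6 (1) first conjunct «`𝒜(μ)` is nonempty» (l. 1966–1969) over the honest `Type 1` object type.
4. `ofFieldOfValues : fieldOfValues E μ →+* muAlgValueField E μ` (the identity on elements, by the tree theorem `fieldOfValues_toSubfield`),
   so that `i_μ` makes every `QHom X (AμOne D)` a `fieldOfValues E μ`-module (scoped instance `endScalarOne`).
5. In the §4.2 setting `C : Sec42Data P5 isotropicAt`: the DIRECT system `K ↦ ℚ ⊗_ℤ Hom_E(A_K, B)` over the sufficiently small levels with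
   the REVERSED inclusion order, transitions = the tree's `Sec42Data.HomQ.pull` (`pull_eq_pre`); `ΩOf C B S := Module.DirectLimit …`
   (= `Hom_E(A_∞, B)_ℚ`, l. 2072), `resOf := DirectLimit.of`, `resOf_pull` (the shape of `Thm418Rest.res_pull`) from
   `Module.DirectLimit.of_f`; at the one object: `ΩOne ∕ resOne ∕ resOne_pull` over `fieldOfValues E μ`, assembled as the product over the
   subsingleton `ObjOne` (all factors definitionally equal; the empty product if `𝒜(μ) = ∅`, which a consumer's `hObj` excludes).
6. CAPSTONE `restOne … : Thm418Rest C` — `Obj ∕ Aμ ∕ Ω ∕ res ∕ res_pull ∕ μ` REAL as above; the OTHER rows' objects `Eps ∕ epsOf ∕ Chi ∕ omega ∕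
   rho` (theta side) and `rhoΩ` (the Hecke translation on `Hom_E(A_∞, A_μ)_ℚ`, l. 2219 / l. 2074) stay PARAMETERS;
   `nonempty_obj_restOne_iff` : its `hObj` ↔ Prop. 4.6 (1); `homK_toThm418Data_restOne` : its `HomK K D` is the REAL group
   `ℚ ⊗_ℤ Hom_E(Alb_{X_{levelOf K}}, A_μ)` at the CHOSEN `A_μ` (by `rfl`).
Design choices.  `EndScalar` is a class (data: the structure map) so that the induced module structures are found by instance search inside
this namespace; its instances are `scoped`, nothing is registered globally (the idiom of `Thm418Rest`'s own instance fields); `open scoped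
Classical` supplies the decidability `Module.DirectLimit` bookkeeping wants.  Deliberately NOT here: `rhoΩ` (TEAM hComp (U7)), the suppliers of
`Nonempty (Def45.CMDatum …)` ([Liu2021] Prop. 4.6 (1) / [Shimura1998] Thm. 21.4 — CARRIERS-PLAN S4), any COR-CM display, any claim about S2.

References: Y. Liu, *Fourier–Jacobi cycles and arithmetic relative trace formula*, Camb. J. Math. 9 (2021) = arXiv:2102.11518 (`FJcycle.tex`
md5 6db49a74122d): Def. 4.5 l. 1936–1964, Prop. 4.6 (1) l. 1966–1969, §4.2 l. 2053–2081, Def. 4.16 / Rem. 4.17 l. 2215–2230, Thm. 4.18 l. 2232–2245.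
-/

noncomputable section

open CategoryTheory NumberField
open scoped TensorProduct
open Literature.AlgebraicGeometry.Motives (AbelianVariety)
open Literature.AlgebraicGeometry.Motives.AbelianVariety (endAlgebra)

namespace Literature.NumberTheory.Automorphic.Liu2021.AppendixC.RestOne

/-! ## 1. `End⁰(B)` acts on `ℚ ⊗_ℤ Hom(X, B)` by postcomposition -/
section PostComp

variable {k : Type} [Field k] (X B : AbelianVariety k)

/-- `ℚ ⊗_ℤ Hom_k(X, B)` — for `X = A_K = Alb_{X_K}`, `B = A_μ` this is the tree's `Sec42Data.HomQ K A_μ`, the group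
`Hom_E(A_K, A_μ)_ℚ` of [Liu2021] Thm. 4.18 (1). [cite: Liu2021, §4.2 FJcycle.tex l. 2070–2072] -/
abbrev QHom : Type := ℚ ⊗[ℤ] (X ⟶ B)

/-- Postcomposition with `β ∈ End(B)`, `φ ↦ φ ≫ β`, as a `ℤ`-linear map (Mathlib `Preadditive.rightComp`). [folklore] -/
def post₀ (β : End B) : (X ⟶ B) →ₗ[ℤ] (X ⟶ B) :=
  (Preadditive.rightComp X (End.asHom β)).toIntLinearMap

/-- `post₀ β φ = φ ≫ β`.  Unfolding, ours. [cite: Liu2021, Def. 4.16 FJcycle.tex l. 2215–2219] -/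
@[simp] theorem post₀_apply (β : End B) (φ : X ⟶ B) : post₀ X B β φ = φ ≫ End.asHom β := rfl

/-- The base change of `post₀ β` to `ℚ ⊗_ℤ Hom(X, B) → ℚ ⊗_ℤ Hom(X, B)`, `ℚ`-linear. [folklore] -/
def post (β : End B) : QHom X B →ₗ[ℚ] QHom X B := (post₀ X B β).baseChange ℚ

/-- `post β (q ⊗ φ) = q ⊗ (φ ≫ β)` (how «`M_μ` acts via `i_μ`»).  Unfolding, ours. [cite: Liu2021, Def. 4.16 FJcycle.tex l. 2215–2219] -/
@[simp] theorem post_tmul (β : End B) (q : ℚ) (φ : X ⟶ B) :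
    post X B β (q ⊗ₜ φ) = q ⊗ₜ (φ ≫ End.asHom β) := by
  simp [post, LinearMap.baseChange_tmul]

/-- `β ↦ (φ ↦ φ ≫ β)` is a ring homomorphism `End(B) → End_ℚ(ℚ ⊗_ℤ Hom(X, B))` (`End(B)` has `β * γ = γ ≫ β`). [folklore] -/
def postRingHom : End B →+* Module.End ℚ (QHom X B) where
  toFun := post X B
  map_one' := TensorProduct.AlgebraTensorModule.ext fun q φ => by
    rw [post_tmul, End.one_def, Category.comp_id]; rfl
  map_mul' β γ := TensorProduct.AlgebraTensorModule.ext fun q φ => by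
    rw [post_tmul, Module.End.mul_apply, post_tmul, post_tmul, End.mul_def, Category.assoc]
  map_zero' := TensorProduct.AlgebraTensorModule.ext fun q φ => by
    rw [post_tmul, LinearMap.zero_apply]
    change q ⊗ₜ[ℤ] (φ ≫ (0 : B ⟶ B)) = 0
    rw [Limits.comp_zero, TensorProduct.tmul_zero]
  map_add' β γ := TensorProduct.AlgebraTensorModule.ext fun q φ => by
    rw [post_tmul, LinearMap.add_apply, post_tmul, post_tmul, ← TensorProduct.tmul_add]
    change q ⊗ₜ[ℤ] (φ ≫ (End.asHom β + End.asHom γ)) = _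
    rw [Preadditive.comp_add]

/-- `postRingHom β = post β`.  Unfolding, ours. [cite: Liu2021, Def. 4.16 FJcycle.tex l. 2215–2219] -/
@[simp] theorem postRingHom_apply (β : End B) : postRingHom X B β = post X B β := rfl

/-- Extension of the postcomposition action to `End⁰(B) = ℚ ⊗_ℤ End(B)` — the tree idiom of
`Motives/AbelianVarietyEndAlgebraIsogenyInvariance.lean` (`Algebra.TensorProduct.lift` of `Algebra.ofId ℚ _` and `postRingHom`). [folklore] -/
def postAlg : B.endAlgebra →ₐ[ℚ] Module.End ℚ (QHom X B) :=
  haveI := AbelianVariety.endAlgebra.isScalarTower_int_rat B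
  Algebra.TensorProduct.lift (Algebra.ofId ℚ _)
    { postRingHom X B with
      commutes' := fun n ↦ RingHom.congr_fun (RingHom.ext_int
        ((postRingHom X B).comp (algebraMap ℤ (End B))) (algebraMap ℤ _)) n }
    (fun q _ ↦ Algebra.commute_algebraMap_left q _)

/-- On `1 ⊗ β` the extension `postAlg` is postcomposition with `β`.  Unfolding, ours. [cite: Liu2021, Def. 4.16 FJcycle.tex l. 2215–2219] -/
theorem postAlg_of (β : End B) : postAlg X B (endAlgebra.of B β) = post X B β := by
  haveI := AbelianVariety.endAlgebra.isScalarTower_int_rat B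
  change Algebra.TensorProduct.lift _ _ _ ((1 : ℚ) ⊗ₜ[ℤ] β) = _
  rw [Algebra.TensorProduct.lift_tmul, map_one, one_mul]
  rfl

/-- **«`M_μ` acts via `i_μ`»** ([Liu2021] Def. 4.16, l. 2219), generically: a ring homomorphism `S → End⁰(B)` recorded as a class
(data: the structure map, e.g. `i_μ : M_μ → End_E(A_μ)_ℚ` of Def. 4.5 (2), l. 1948), so that the induced module structures are found by
instance search; instances of it in this file are `scoped`. [cite: Liu2021, Def. 4.16 FJcycle.tex l. 2215–2219] -/
class EndScalar (S : Type) [Semiring S] (B : AbelianVariety k) : Type where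
  /-- the structure map (`i_μ : M_μ → End_E(A_μ)_ℚ`, Def. 4.5 (2), l. 1948). -/
  hom : S →+* B.endAlgebra

/-- The `S`-module `ℚ ⊗_ℤ Hom(X, B)` induced by `EndScalar S B`: `s • t := postAlg (hom s) t` (`Module.compHom`).  SCOPED instance
(`open Literature.NumberTheory.Automorphic.Liu2021.AppendixC.RestOne` to activate). [folklore] -/
scoped instance moduleQHom (S : Type) [Semiring S] [h : EndScalar S B] : Module S (QHom X B) :=
  Module.compHom (QHom X B) ((postAlg X B).toRingHom.comp h.hom)

/-- Unfolding the scalar action «`M_μ` acts via `i_μ`»: `s • t = postAlg (hom s) t`.  Ours. [cite: Liu2021, Def. 4.16 FJcycle.tex l. 2215–2219] -/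
theorem smul_def (S : Type) [Semiring S] [h : EndScalar S B] (s : S) (t : QHom X B) :
    s • t = postAlg X B (h.hom s) t := rfl

variable {X} {X' : AbelianVariety k}

/-- Precomposition with `u : X' → X`, base-changed to `ℚ ⊗_ℤ –` (`q ⊗ φ ↦ q ⊗ (u ≫ φ)`), `ℚ`-linear (Mathlib `Preadditive.leftComp`).
[folklore] -/
def pre (u : X' ⟶ X) : QHom X B →ₗ[ℚ] QHom X' B :=
  (Preadditive.leftComp B u).toIntLinearMap.baseChange ℚ

/-- `pre u (q ⊗ φ) = q ⊗ (u ≫ φ)` (the pull-back of §4.2, cf. `Sec42Data.HomQ.pull_tmul`).  Unfolding, ours. [cite: Liu2021, §4.2 FJcycle.tex l. 2070–2072] -/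
@[simp] theorem pre_tmul (u : X' ⟶ X) (q : ℚ) (φ : X ⟶ B) : pre B u (q ⊗ₜ φ) = q ⊗ₜ (u ≫ φ) := by
  simp [pre, LinearMap.baseChange_tmul]; rfl

/-- Pre- and post-composition commute (associativity of `≫`), as linear maps — why the pull-backs of §4.2 are `M_μ`-linear (Def. 4.16,
l. 2219).  Ours. [cite: Liu2021, Def. 4.16 FJcycle.tex l. 2219] -/
theorem pre_comp_post (u : X' ⟶ X) (β : End B) : pre B u ∘ₗ post X B β = post X' B β ∘ₗ pre B u :=
  TensorProduct.AlgebraTensorModule.ext fun q φ => by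
    rw [LinearMap.comp_apply, LinearMap.comp_apply, post_tmul, pre_tmul, pre_tmul, post_tmul, Category.assoc]

/-- Pre- and post-composition commute, pointwise.  Ours. [cite: Liu2021, Def. 4.16 FJcycle.tex l. 2219] -/
theorem pre_post (u : X' ⟶ X) (β : End B) (t : QHom X B) :
    pre B u (post X B β t) = post X' B β (pre B u t) :=
  LinearMap.congr_fun (pre_comp_post B u β) t

/-- Precomposition commutes with the whole `End⁰(B)`-action (normal form `e = M⁻¹ · (1 ⊗ F)`, tree `endAlgebra.exists_eq_algebraMap_mul_of`)
— the `M_μ`-linearity of the pull-backs (Def. 4.16, l. 2219).  Ours. [cite: Liu2021, Def. 4.16 FJcycle.tex l. 2219] -/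
theorem pre_postAlg (u : X' ⟶ X) (e : B.endAlgebra) (t : QHom X B) :
    pre B u (postAlg X B e t) = postAlg X' B e (pre B u t) := by
  obtain ⟨M, F, -, rfl⟩ := AbelianVariety.endAlgebra.exists_eq_algebraMap_mul_of e
  rw [map_mul, map_mul, AlgHom.commutes, AlgHom.commutes, postAlg_of, postAlg_of, Module.End.mul_apply,
    Module.End.mul_apply, Module.algebraMap_end_apply, Module.algebraMap_end_apply, map_smul, pre_post]

/-- Precomposition is `S`-linear for the `EndScalar`-induced module structures. [folklore] -/
def preₛ (S : Type) [Semiring S] [EndScalar S B] (u : X' ⟶ X) : QHom X B →ₗ[S] QHom X' B :=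
  { (pre B u).toAddMonoidHom with
    map_smul' := fun s t => by
      change pre B u (postAlg X B _ t) = postAlg X' B _ (pre B u t)
      exact pre_postAlg B u _ t }

/-- `preₛ u t = pre u t`.  Unfolding, ours. [cite: Liu2021, §4.2 FJcycle.tex l. 2070–2072] -/
@[simp] theorem preₛ_apply (S : Type) [Semiring S] [EndScalar S B] (u : X' ⟶ X) (t : QHom X B) :
    preₛ B S u t = pre B u t := rfl

end PostComp

/-! ## 2. The one-object index `Obj` and `Aμ` -/
section OneObject

variable {E : Type} [Field E] [NumberField E] [IsCMField E]
variable {L : Type} [Field L] [NumberField L] [IsGalois ℚ L] (φ : E →ₐ[ℚ] L) (ι : L →+* ℂ)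
variable {μ : IdeleClassGroup E →ₜ* Circle} (hμ : IdeleClassGroup.IsConjugateSymplectic E μ)
  (hw : IdeleClassGroup.HasWeight E μ 1) (Car : Def45.Carriers E μ)

/-- **`Obj` at the instance**: `PLift` of [Liu2021] Prop. 4.6 (1)'s first conjunct «`𝒜(μ)` is nonempty» over the honest (`Type 1`)
object type `Def45.CMDatum φ ι hμ hw Car` (Def. 4.5 (2) as printed); a `Type`, as `Thm418Rest.Obj` demands, and a subsingleton — Liu's
proof of Thm. 4.18 fixes ONE arbitrary object (l. 2232) and identifies `Ω(μ)` with `Hom_E(A_∞, A_μ)_ℚ` (Rem. 4.17).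
[cite: Liu2021, Prop. 4.6 (1) FJcycle.tex l. 1966–1969 and Thm. 4.18 proof l. 2232] -/
abbrev ObjOne : Type := PLift (Nonempty (Def45.CMDatum φ ι hμ hw Car))

/-- `ObjOne` is a subsingleton (it is `PLift` of a proposition). [folklore] -/
instance subsingleton_objOne : Subsingleton (ObjOne φ ι hμ hw Car) := ⟨fun ⟨_⟩ ⟨_⟩ => rfl⟩

/-- A consumer's `hObj : Nonempty Obj` at the instance IS [Liu2021] Prop. 4.6 (1) «`𝒜(μ)` nonempty», over the honest type.
[cite: Liu2021, Prop. 4.6 (1) FJcycle.tex l. 1966–1969] -/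
theorem nonempty_objOne_iff : Nonempty (ObjOne φ ι hμ hw Car) ↔ Nonempty (Def45.CMDatum φ ι hμ hw Car) :=
  ⟨fun ⟨D⟩ => D.down, fun h => ⟨⟨h⟩⟩⟩

/-- The chosen datum `D_μ` («Take an arbitrary object `D_μ ∈ 𝒜(μ)`», proof of Thm. 4.18, l. 2232): `Classical.choice` of the
proposition carried by the index; definitionally INDEPENDENT of `D : ObjOne` (proof irrelevance), which is what lets `Ω` below be built
with no hypothesis. [cite: Liu2021, Thm. 4.18 proof FJcycle.tex l. 2232] -/
def datum (D : ObjOne φ ι hμ hw Car) : Def45.CMDatum φ ι hμ hw Car := Classical.choice D.down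

/-- `A_μ` at the instance: the REAL field `A` of the chosen `Def45.CMDatum` («`A_μ` is an abelian variety over `E`», Def. 4.5 (2) first
bullet, l. 1944). [cite: Liu2021, Def. 4.5 (2) FJcycle.tex l. 1944] -/
def AμOne (D : ObjOne φ ι hμ hw Car) : AbelianVariety E := (datum φ ι hμ hw Car D).A

/-- The COR-CM END displays' reading binder `i` at the instance — a PROJECTION: `i_μ : M_μ → End_E(A_μ)_ℚ` of the chosen datum
(Def. 4.5 (2), l. 1948). [cite: Liu2021, Def. 4.5 (2) FJcycle.tex l. 1946–1948] -/
def iOne (D : ObjOne φ ι hμ hw Car) : IdeleClassGroup.muAlgValueField E μ →+* (AμOne φ ι hμ hw Car D).endAlgebra :=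
  (datum φ ι hμ hw Car D).i

/-- The END displays' reading binder `hdim` at the instance — a PROJECTION: `[M_μ : ℚ] = 2 · dim A_μ` («CM structure», Def. 4.5 (2),
l. 1946–1948; `Def45.CMDatum.finrank_eq`). [cite: Liu2021, Def. 4.5 (2) FJcycle.tex l. 1946–1948] -/
theorem hdimOne (D : ObjOne φ ι hμ hw Car) :
    Module.finrank ℚ (IdeleClassGroup.muAlgValueField E μ) = 2 * (AμOne φ ι hμ hw Car D).dim :=
  (datum φ ι hμ hw Car D).finrank_eq

/-- The END displays' reading binder `hdet45` at the instance — a PROJECTION: the first bullet of Def. 4.5 (2) (l. 1950), the determinant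
of `i_μ(x)` on `Lie_E(A_μ)` read on the cotangent space through `ι` (`Def45.CMDatum.det45`), for the SAME chosen datum as `iOne`.
[cite: Liu2021, Def. 4.5 (2) first bullet FJcycle.tex l. 1950] -/
theorem hdet45One (D : ObjOne φ ι hμ hw Car) (x : IdeleClassGroup.muAlgValueField E μ) (M : ℕ)
    (f : End (AμOne φ ι hμ hw Car D)) (hM : M ≠ 0)
    (hx : iOne φ ι hμ hw Car D x = algebraMap ℚ _ (M : ℚ)⁻¹ * endAlgebra.of _ f) :
    LinearMap.det (AbelianVariety.cotangentMap _ f) = (M : E) ^ (AμOne φ ι hμ hw Car D).dim * Def45.eta φ ι hμ x :=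
  (datum φ ι hμ hw Car D).det45 x M f hM hx

/-- Two indices give the SAME abelian variety, definitionally (proof irrelevance of `D.down`).  Ours. [cite: Liu2021, Thm. 4.18 proof l. 2232] -/
theorem aμOne_eq (D D' : ObjOne φ ι hμ hw Car) : AμOne φ ι hμ hw Car D = AμOne φ ι hμ hw Car D' := rfl

end OneObject

/-! ## 3. The as-printed scalar field `fieldOfValues E μ` → the tree's `muAlgValueField E μ` -/
section Bridge

variable (E : Type) [Field E] [NumberField E] (μ : IdeleClassGroup E →ₜ* Circle)

/-- The identity on elements `M_μ (as printed: an intermediate field of ℂ/ℚ, `fieldOfValues E μ`, Def. 4.3 l. 1908–1912) → M_μ (the tree's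
subfield `muAlgValueField E μ` of ℂ)`, by the tree theorem `fieldOfValues_toSubfield`. [cite: Liu2021, Def. 4.3 FJcycle.tex l. 1908–1912] -/
def ofFieldOfValues : fieldOfValues E μ →+* IdeleClassGroup.muAlgValueField E μ where
  toFun z := ⟨(z : ℂ), by rw [← fieldOfValues_toSubfield E μ]; exact z.2⟩
  map_one' := Subtype.ext rfl
  map_mul' _ _ := Subtype.ext rfl
  map_zero' := Subtype.ext rfl
  map_add' _ _ := Subtype.ext rfl

/-- `ofFieldOfValues` is the identity on complex numbers (`M_μ ⊂ ℂ`, Def. 4.3).  Unfolding, ours. [cite: Liu2021, Def. 4.3 FJcycle.tex l. 1908–1912] -/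
@[simp] theorem coe_ofFieldOfValues (z : fieldOfValues E μ) :
    ((ofFieldOfValues E μ z : IdeleClassGroup.muAlgValueField E μ) : ℂ) = z :=
  rfl

end Bridge

/-! ## 4. `Ω ∕ res ∕ res_pull` in the §4.2 setting -/
section Omega

variable {F E : Type} [Field F] [NumberField F] [IsTotallyReal F] [Field E] [NumberField E] [Algebra F E]
  [IsTotallyComplex E] [Algebra.IsQuadraticExtension F E]
variable {P5 : PropC5Data F E} {isotropicAt : ℕ → Prop} (C : Sec42Data P5 isotropicAt)
variable (B : AbelianVariety E) (S : Type) [Ring S] [EndScalar S B]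

open scoped Classical

/-- The index of the DIRECT system `K ↦ Hom_E(A_K, B)_ℚ`: the sufficiently small levels `C5.SmallLevel C.S.K₀` with the REVERSED inclusion
order (`A_∞ = "lim" A_K`, §4.2 l. 2070–2072). [cite: Liu2021, §4.2 FJcycle.tex l. 2070–2072] -/
abbrev Idx : Type := (C5.SmallLevel C.S.K₀)ᵒᵈ

/-- The objects `K ↦ ℚ ⊗_ℤ Hom_E(A_K, B)` of the direct system, on the reversed index. [cite: Liu2021, §4.2 FJcycle.tex l. 2070–2072] -/
abbrev sysObj (i : Idx C) : Type := QHom (C.A (OrderDual.ofDual i)) B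

/-- The transitions of the direct system: pull-back along `Alb_{u^{K'}_K}` for `K' ⊆ K` (`Sec42Data.Atr`), `S`-linear (`preₛ`).
[cite: Liu2021, §4.2 FJcycle.tex l. 2064–2072] -/
def sys (i j : Idx C) (h : i ≤ j) : sysObj C B i →ₗ[S] sysObj C B j :=
  preₛ B S (C.Atr (homOfLE (show OrderDual.ofDual j ≤ OrderDual.ofDual i from h)))

/-- The tree's `Sec42Data.HomQ.pull` IS base-changed precomposition, pointwise.  Unfolding, ours. [cite: Liu2021, §4.2 FJcycle.tex l. 2070–2072] -/
theorem pull_eq_pre {K K' : C5.SmallLevel C.S.K₀} (f : K' ⟶ K) (t : C.HomQ K B) :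
    Sec42Data.HomQ.pull C f B t = pre B (C.Atr f) t := by
  have h : Sec42Data.HomQ.pull C f B = (pre B (C.Atr f)).restrictScalars ℤ :=
    TensorProduct.ext' fun q φ => by rw [LinearMap.restrictScalars_apply, Sec42Data.HomQ.pull_tmul, pre_tmul]
  exact LinearMap.congr_fun h t

/-- **`Ω` for the object `B`**: `colim_K ℚ ⊗_ℤ Hom_E(A_K, B)` as an `S`-module (`Module.DirectLimit`) — `Hom_E(A_∞, B)_ℚ` (l. 2072); at
`B = A_μ`, `S = M_μ` acting via `i_μ` this is `Ω(μ)` by Rem. 4.17. [cite: Liu2021, §4.2 FJcycle.tex l. 2070–2072 and Rem. 4.17] -/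
abbrev ΩOf : Type := Module.DirectLimit (sysObj C B) (sys C B S)

/-- `res_K : ℚ ⊗_ℤ Hom_E(A_K, B) → Ω` — the canonical map of l. 2070–2072 (`Module.DirectLimit.of`), as a group homomorphism.
[cite: Liu2021, §4.2 FJcycle.tex l. 2070–2072] -/
def resOf (K : C5.SmallLevel C.S.K₀) : C.HomQ K B →+ ΩOf C B S :=
  (Module.DirectLimit.of S (Idx C) (sysObj C B) (sys C B S) (OrderDual.toDual K)).toAddMonoidHom

/-- READING G2 at the instance: `res_{K'} ∘ (Alb_{u^{K'}_K})^* = res_K` for `K' ⊆ K` — the shape of `Thm418Rest.res_pull`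
(`Module.DirectLimit.of_f`). [cite: Liu2021, §4.2 FJcycle.tex l. 2070–2072] -/
theorem resOf_pull {K K' : C5.SmallLevel C.S.K₀} (f : K' ⟶ K) (t : C.HomQ K B) :
    resOf C B S K' (Sec42Data.HomQ.pull C f B t) = resOf C B S K t := by
  have hle : K' ≤ K := leOfHom f
  have hf : f = homOfLE hle := Subsingleton.elim _ _
  have key := @Module.DirectLimit.of_f S _ (Idx C) _ (sysObj C B) _ _ (sys C B S) _
    (OrderDual.toDual K) (OrderDual.toDual K') hle t
  have hsys : sys C B S (OrderDual.toDual K) (OrderDual.toDual K') hle t = Sec42Data.HomQ.pull C f B t := by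
    rw [pull_eq_pre, hf]; rfl
  rw [hsys] at key
  exact key

end Omega

/-! ## 5. Assembly at the one object over the as-printed scalar field -/
section Assembly

variable {F E : Type} [Field F] [NumberField F] [IsTotallyReal F] [Field E] [NumberField E] [Algebra F E]
  [IsTotallyComplex E] [Algebra.IsQuadraticExtension F E] [IsCMField E]
variable {P5 : PropC5Data F E} {isotropicAt : ℕ → Prop} (C : Sec42Data P5 isotropicAt)
variable {L : Type} [Field L] [NumberField L] [IsGalois ℚ L] (φ : E →ₐ[ℚ] L) (ι : L →+* ℂ)
variable {μ : IdeleClassGroup E →ₜ* Circle} (hμ : IdeleClassGroup.IsConjugateSymplectic E μ)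
  (hw : IdeleClassGroup.HasWeight E μ 1) (Car : Def45.Carriers E μ)

/-- «`M_μ` acts via `i_μ`» at the chosen object, for the AS-PRINTED scalar field `fieldOfValues E μ` of `Thm418Rest.instModuleΩ`:
the structure map `i_μ ∘ ofFieldOfValues`.  SCOPED instance. [cite: Liu2021, Def. 4.16 FJcycle.tex l. 2215–2219] -/
scoped instance endScalarOne (D : ObjOne φ ι hμ hw Car) : EndScalar (fieldOfValues E μ) (AμOne φ ι hμ hw Car D) :=
  ⟨(iOne φ ι hμ hw Car D).comp (ofFieldOfValues E μ)⟩

open scoped Classical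

/-- **`Ω` at the instance**, with NO hypothesis: the product over the subsingleton `ObjOne` of the colimits `Hom_E(A_∞, A_μ)_ℚ` (one
factor, = `Ω(μ)` by Rem. 4.17, as soon as `𝒜(μ) ≠ ∅`, i.e. under a consumer's `hObj`; the empty product otherwise).
[cite: Liu2021, Def. 4.16 and Rem. 4.17 FJcycle.tex l. 2215–2230] -/
abbrev ΩOne : Type := ∀ D : ObjOne φ ι hμ hw Car, ΩOf C (AμOne φ ι hμ hw Car D) (fieldOfValues E μ)

/-- **`res` at the instance**: `res_K` into every factor (all factors `AμOne D'` are definitionally `AμOne D`).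
[cite: Liu2021, §4.2 FJcycle.tex l. 2070–2072] -/
def resOne (K : C5.SmallLevel C.S.K₀) (D : ObjOne φ ι hμ hw Car) :
    C.HomQ K (AμOne φ ι hμ hw Car D) →+ ΩOne C φ ι hμ hw Car where
  toFun t := fun D' => resOf C (AμOne φ ι hμ hw Car D') (fieldOfValues E μ) K t
  map_zero' := funext fun _ => map_zero _
  map_add' _ _ := funext fun _ => map_add _ _ _

/-- **`res_pull` at the instance** — literally the field `Thm418Rest.res_pull` (READING G2). [cite: Liu2021, §4.2 FJcycle.tex l. 2070–2072] -/
theorem resOne_pull {K K' : C5.SmallLevel C.S.K₀} (f : K' ⟶ K) (D : ObjOne φ ι hμ hw Car)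
    (t : C.HomQ K (AμOne φ ι hμ hw Car D)) :
    resOne C φ ι hμ hw Car K' D (Sec42Data.HomQ.pull C f (AμOne φ ι hμ hw Car D) t) = resOne C φ ι hμ hw Car K D t :=
  funext fun D' => resOf_pull C (AμOne φ ι hμ hw Car D') (fieldOfValues E μ) f t

/-- **CAPSTONE — the one-object rest**: a `Thm418Rest C` whose `Obj ∕ Aμ ∕ Ω ∕ res ∕ res_pull` (and `μ` with its two Prop fields
`isConjugateSymplectic`, `hasWeight_one`) are the REAL objects above, built with NO hypothesis from the Def. 4.5 (2) character datum
`(μ, hμ, hw, Car)` and `(φ, ι)`; the remaining fields are the OTHER rows' objects, taken as parameters: `Eps ∕ epsOf ∕ Chi ∕ omega ∕ rho`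
(theta side, Def. 4.11 / 4.12) and `rhoΩ` (the Hecke translation on `Hom_E(A_∞, A_μ)_ℚ`, l. 2219 / l. 2074 — not constructed here).
[cite: Liu2021, Thm. 4.18 FJcycle.tex l. 2232–2245 with Def. 4.5 (2), Def. 4.16, Rem. 4.17] -/
def restOne (Eps : Type) (epsOf : E → Eps) (Chi : Type) (omega : Eps → Chi → Type)
    [∀ ε χ, AddCommGroup (omega ε χ)] [∀ ε χ, Module ℂ (omega ε χ)] (rho : ∀ ε χ, Representation ℂ C.G (omega ε χ))
    (rhoΩ : Representation (fieldOfValues E μ) C.G (ΩOne C φ ι hμ hw Car)) : Thm418Rest C where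
  Eps := Eps
  epsOf := epsOf
  Chi := Chi
  μ := μ
  isConjugateSymplectic := hμ
  hasWeight_one := hw
  Obj := ObjOne φ ι hμ hw Car
  Aμ := AμOne φ ι hμ hw Car
  omega := omega
  rho := rho
  Ω := ΩOne C φ ι hμ hw Car
  rhoΩ := rhoΩ
  res := resOne C φ ι hμ hw Car
  res_pull f D t := resOne_pull C φ ι hμ hw Car f D t

/-- For `restOne` a consumer's END binder `hObj : Nonempty (toThm418Data C R).Obj` IS [Liu2021] Prop. 4.6 (1) «`𝒜(μ)` nonempty» over
the honest object type `Def45.CMDatum φ ι hμ hw Car` — the cite enters at its printed binder with its printed meaning.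
[cite: Liu2021, Prop. 4.6 (1) FJcycle.tex l. 1966–1969] -/
theorem nonempty_obj_restOne_iff (Eps : Type) (epsOf : E → Eps) (Chi : Type) (omega : Eps → Chi → Type)
    [∀ ε χ, AddCommGroup (omega ε χ)] [∀ ε χ, Module ℂ (omega ε χ)] (rho : ∀ ε χ, Representation ℂ C.G (omega ε χ))
    (rhoΩ : Representation (fieldOfValues E μ) C.G (ΩOne C φ ι hμ hw Car)) :
    Nonempty (toThm418Data C (restOne C φ ι hμ hw Car Eps epsOf Chi omega rho rhoΩ)).Obj ↔
      Nonempty (Def45.CMDatum φ ι hμ hw Car) :=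
  nonempty_objOne_iff φ ι hμ hw Car

/-- For `restOne` the group `HomK K D` of `toThm418Data C _` ([Liu2021] Thm. 4.18 (1), `Hom_E(A_K, A_μ)_ℚ`) is the REAL group
`ℚ ⊗_ℤ Hom_E(Alb_{X_{levelOf K}}, A_μ)` at the CHOSEN `A_μ = (datum D).A`, by `rfl`. [cite: Liu2021, Thm. 4.18 (1) FJcycle.tex l. 2235–2238] -/
theorem homK_toThm418Data_restOne (Eps : Type) (epsOf : E → Eps) (Chi : Type) (omega : Eps → Chi → Type)
    [∀ ε χ, AddCommGroup (omega ε χ)] [∀ ε χ, Module ℂ (omega ε χ)] (rho : ∀ ε χ, Representation ℂ C.G (omega ε χ))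
    (rhoΩ : Representation (fieldOfValues E μ) C.G (ΩOne C φ ι hμ hw Car)) (K : Subgroup C.G) (D : ObjOne φ ι hμ hw Car) :
    (toThm418Data C (restOne C φ ι hμ hw Car Eps epsOf Chi omega rho rhoΩ)).HomK K D =
      C.HomQ (C.levelOf K) (datum φ ι hμ hw Car D).A :=
  rfl

end Assembly

end Literature.NumberTheory.Automorphic.Liu2021.AppendixC.RestOne

end
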